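import Literature.Topology.FourManifolds.DiscRemovalClosedModel
import Literature.Topology.FourManifolds.BoundaryGluingData
import Literature.Topology.FourManifolds.OpenCollarExistence
import HarnessLib

/-!
# Attaching a disc to a null-cobordism of the sphere, I: the disc of `M₀ ∪ Dⁿ⁺¹` is a chart ball

Topic `Literature/Topology/FourManifolds`. First half of the converse bookkeeping to
`DiscRemovalClosedModel.lean` (which removes a disc from a closed manifold), needed to pass from
Kervaire–Milnor's bounded manifolds to the closed manifolds of Milnor–Kervaire and Kosinski:
Kervaire–Milnor, *Groups of homotopy spheres: I*, Ann. of Math. (2) 77 (1963), p. 529, consider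
"the collection of all `4m`-manifolds `M₀` which are s-parallelizable, and are bounded by the
`(4m-1)`-sphere" and their signatures `σ(M₀)`, computed (footnote pp. 528–529) on the "closed
homology manifold with the same signature" obtained by adjoining "a cone over the boundary" — the
tree's `Literature.Topology.FourManifolds.ClosedModel n M₀ = M₀ ∪ cone(bM₀)` — while the
divisibility they quote (p. 530, from their reference [18] = Milnor–Kervaire, Proc. ICM 1958,
p. 457) is a statement about **closed** manifolds, the passage being "attaching a disc to the
boundary of `M₁` produces a closed manifold `M`" (Kosinski, *Differential Manifolds* (1993), proof
of IX.8.7, last paragraph; inversely "removing the interior of an imbedded `4m`-disk",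
Kervaire–Milnor, proof of Lemma 7.4, p. 529).

Setting: a null-cobordism `c` of the **standard** sphere `𝕊ⁿ` (`M₀ = c.W`, `bM₀ = 𝕊ⁿ`), a smooth
manifold `X` with gluing data `G` exhibiting it as `M₀ ∪_{id} 𝔻ⁿ⁺¹` (the tree's
`BoundaryGluingData c.boundaryData (closedBallBoundaryData n) (Equiv.refl 𝕊ⁿ) X`: smooth
embeddings `jA : M₀ → X`, `jB : 𝔻ⁿ⁺¹ → X` covering `X` and meeting exactly along `bM₀ ≡ 𝕊ⁿ`), and a
long open collar `C` of `bM₀` in `M₀` (`BoundaryData.OpenCollar`; these exist,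
`BoundaryData.nonempty_openCollar`). Everything is PROVED; no definitions, no named facts:

* `NullCobordism.exists_capChart` — **the cap chart** `e : ℝⁿ⁺¹ → X`: `e v = jB v` for `‖v‖ ≤ 1`
  and `e ((1 + t) z) = jA (C z t)` for `z ∈ 𝕊ⁿ`, `t ≥ 0` (polar coordinates outside the unit
  ball; the prescriptions agree on `𝕊ⁿ` by the gluing relation `jA (incl z) = jB z`). All further
  lemmas are stated for ANY `e` satisfying these two equations (`h₁`, `h₂`).
* `capChart_mem_range_jB_iff`, `image_closedBall_of_capChart`, `capChart_zero` — `e` meets the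
  disc piece exactly on the unit ball, `e(𝔻ⁿ⁺¹) = jB(𝔻ⁿ⁺¹)`, `e 0 = jB 0`.
* `injective_capChart`, `continuous_capChart` (pasting over the closed cover
  `{‖v‖ ≤ 1} ∪ {1 ≤ ‖v‖}`), `preimage_jB_image_capChart`, `preimage_jA_image_capChart` (traces of
  `e(U)` on the two pieces), `isOpenMap_capChart` (open-cover criterion of the gluing,
  `BoundaryGluingData.isOpen_of_preimage`), and finally
* `NullCobordism.isOpenEmbedding_of_capChart` — **`e` is an open topological embedding**, i.e. the
  disc `jB(𝔻ⁿ⁺¹) ⊂ X` is the unit ball of a chart ball `e(ℝⁿ⁺¹) = jB(𝔻ⁿ⁺¹) ∪ jA(collar)`.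

Consumer: `DiscAttachmentClosedModel.lean` (collapsing `e(𝔻ⁿ⁺¹)` gives `M₀ ∪ cone(bM₀) ≃ₜ X` and
`σ(M₀) = σ(X)`), then `HomotopySpheresSigmaTwoDivides.lean`.

## References

* M. A. Kervaire, J. W. Milnor, *Groups of homotopy spheres: I*, Ann. of Math. (2) 77 (1963),
  504–537: §7, p. 529 (the manifolds `M₀`; proof of Lemma 7.4), footnote pp. 528–529.
  [KervaireMilnorAnnals1963]
* A. Kosinski, *Differential Manifolds*, Academic Press (1993), IX.8.7, last paragraph of the proof
  ("Attaching a disc to the boundary of `M₁` produces a closed manifold `M`"). [Kosinski1993]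
* T. Bröcker, K. Jänich, *Introduction to Differential Topology*, CUP (1982), (13.5)–(13.11)
  (collars `∂M × ℝ₊ → M` and the gluing `M ∪_φ N`). [BrockerJanich1982]
-/

open scoped Manifold ContDiff Topology
open Set Function Metric Topology

noncomputable section

universe u

namespace Literature.Topology.FourManifolds

/-! ### Polar coordinates about the unit sphere -/

namespace DiscAttachment

variable {n : ℕ}

/-- `‖(1 + t) z‖ = 1 + t` for `z` on the unit sphere and `t ≥ 0`. [folklore] -/
theorem norm_one_add_smul_sphere (z : sphere (0 : EuclideanSpace ℝ (Fin (n + 1))) 1) {t : ℝ}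
    (ht : 0 ≤ t) : ‖(1 + t) • (z : EuclideanSpace ℝ (Fin (n + 1)))‖ = 1 + t := by
  rw [norm_smul, norm_eq_of_mem_sphere z, mul_one, Real.norm_eq_abs, abs_of_nonneg (by linarith)]

/-- The normalisation `v / ‖v‖` of a vector of norm `≥ 1` lies on the unit sphere. [folklore] -/
theorem norm_inv_smul_mem_sphere {v : EuclideanSpace ℝ (Fin (n + 1))} (hv : 1 ≤ ‖v‖) :
    ‖v‖⁻¹ • v ∈ sphere (0 : EuclideanSpace ℝ (Fin (n + 1))) 1 := by
  rw [mem_sphere_zero_iff_norm, norm_smul, norm_inv, norm_norm, inv_mul_cancel₀ (by linarith)]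

/-- Polar decomposition about the unit sphere: `v = (1 + (‖v‖ - 1)) (v / ‖v‖)` for `‖v‖ ≥ 1`.
[folklore] -/
theorem one_add_smul_norm_inv_smul {v : EuclideanSpace ℝ (Fin (n + 1))} (hv : 1 ≤ ‖v‖) :
    (1 + (‖v‖ - 1)) • (‖v‖⁻¹ • v) = v := by
  rw [add_sub_cancel, smul_inv_smul₀ (by linarith)]

/-- Pasting continuity over two closed sets covering the space. [folklore] -/
theorem continuous_of_continuousOn_union_isClosed {α β : Type*} [TopologicalSpace α]
    [TopologicalSpace β] {f : α → β} {s t : Set α} (hs : IsClosed s) (ht : IsClosed t)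
    (hst : s ∪ t = univ) (hfs : ContinuousOn f s) (hft : ContinuousOn f t) : Continuous f := by
  rw [continuous_iff_isClosed]
  intro F hF
  have : f ⁻¹' F = s ∩ f ⁻¹' F ∪ t ∩ f ⁻¹' F := by
    rw [← union_inter_distrib_right, hst, univ_inter]
  rw [this]
  exact (hfs.preimage_isClosed_of_isClosed hs hF).union (hft.preimage_isClosed_of_isClosed ht hF)

end DiscAttachment

/-! ### The disc chart of a capped null-cobordism -/

namespace NullCobordism

open DiscAttachment

variable {n : ℕ} (c : NullCobordism n (sphere (0 : EuclideanSpace ℝ (Fin (n + 1))) 1))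
  {X : Type*} [TopologicalSpace X] [ChartedSpace (EuclideanSpace ℝ (Fin (n + 1))) X]
  (G : BoundaryGluingData c.boundaryData (closedBallBoundaryData n)
    (Equiv.refl (sphere (0 : EuclideanSpace ℝ (Fin (n + 1))) 1)) X)
  (C : c.boundaryData.OpenCollar) {e : EuclideanSpace ℝ (Fin (n + 1)) → X}

/-- The gluing relation of `M₀ ∪_{id} 𝔻ⁿ⁺¹` in plain terms: `jA a = jB b` iff `a = incl z` and
`b = z` for some `z ∈ 𝕊ⁿ`. [folklore] -/
theorem cap_jA_eq_jB_iff (a : c.W)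
    (b : Metric.closedBall (0 : EuclideanSpace ℝ (Fin (n + 1))) 1) :
    G.jA a = G.jB b ↔ ∃ z : sphere (0 : EuclideanSpace ℝ (Fin (n + 1))) 1,
      a = c.incl z ∧ (b : EuclideanSpace ℝ (Fin (n + 1))) = z := by
  refine (G.jA_eq_jB_iff a b).trans ⟨?_, ?_⟩
  · rintro ⟨z, rfl, rfl⟩
    exact ⟨z, rfl, rfl⟩
  · rintro ⟨z, rfl, hb⟩
    exact ⟨z, rfl, Subtype.ext hb⟩

/-- On the seam both gluing maps agree: `jA (incl z) = jB z`. [folklore] -/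
theorem cap_jA_incl (z : sphere (0 : EuclideanSpace ℝ (Fin (n + 1))) 1) :
    G.jA (c.incl z) = G.jB ⟨z, sphere_subset_closedBall z.2⟩ :=
  (cap_jA_eq_jB_iff c G _ _).2 ⟨z, rfl, rfl⟩

/-- **Existence of the cap chart**: `e v = jB v` on the unit ball and `e ((1 + t) z) = jA (C z t)`
outside it define a function `ℝⁿ⁺¹ → X` (the two prescriptions agree on the unit sphere, where
`jA (incl z) = jB z` is the gluing relation and `C z 0 = incl z`). [folklore] -/
theorem exists_capChart :
    ∃ e : EuclideanSpace ℝ (Fin (n + 1)) → X,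
      (∀ (v : EuclideanSpace ℝ (Fin (n + 1))) (hv : ‖v‖ ≤ 1),
        e v = G.jB ⟨v, mem_closedBall_zero_iff.2 hv⟩) ∧
      ∀ (z : sphere (0 : EuclideanSpace ℝ (Fin (n + 1))) 1) (t : ℝ), 0 ≤ t →
        e ((1 + t) • (z : EuclideanSpace ℝ (Fin (n + 1)))) = G.jA (C.toFun z t) := by
  refine ⟨fun v => if hv : ‖v‖ ≤ 1 then G.jB ⟨v, mem_closedBall_zero_iff.2 hv⟩
    else G.jA (C.toFun ⟨‖v‖⁻¹ • v, norm_inv_smul_mem_sphere (not_le.1 hv).le⟩ (‖v‖ - 1)),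
    fun v hv => dif_pos hv, fun z t ht => ?_⟩
  rcases ht.eq_or_lt with rfl | hpos
  · have h1 : ‖(1 + (0 : ℝ)) • (z : EuclideanSpace ℝ (Fin (n + 1)))‖ ≤ 1 := by
      rw [norm_one_add_smul_sphere z le_rfl]; norm_num
    simp only [h1, dif_pos]
    rw [C.apply_zero, NullCobordism.boundaryData_incl, cap_jA_incl]
    congr 1
    apply Subtype.ext
    simp
  · have hn : ‖(1 + t) • (z : EuclideanSpace ℝ (Fin (n + 1)))‖ = 1 + t :=
      norm_one_add_smul_sphere z ht
    have h1 : ¬ ‖(1 + t) • (z : EuclideanSpace ℝ (Fin (n + 1)))‖ ≤ 1 := by rw [hn]; linarith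
    simp only [h1, dif_neg, not_false_eq_true]
    have hz : (⟨‖(1 + t) • (z : EuclideanSpace ℝ (Fin (n + 1)))‖⁻¹ •
          ((1 + t) • (z : EuclideanSpace ℝ (Fin (n + 1)))),
        norm_inv_smul_mem_sphere (not_le.1 h1).le⟩ :
          sphere (0 : EuclideanSpace ℝ (Fin (n + 1))) 1) = z := by
      apply Subtype.ext
      simp only [hn, smul_smul]
      rw [inv_mul_cancel₀ (by linarith), one_smul]
    rw [hz, hn, add_sub_cancel_left]

/-- On vectors of norm `≥ 1` the cap chart is the collar in polar coordinates:
`e v = jA (C (v/‖v‖) (‖v‖ - 1))`. [folklore] -/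
theorem capChart_apply_of_one_le
    (h₂ : ∀ (z : sphere (0 : EuclideanSpace ℝ (Fin (n + 1))) 1) (t : ℝ), 0 ≤ t →
      e ((1 + t) • (z : EuclideanSpace ℝ (Fin (n + 1)))) = G.jA (C.toFun z t))
    {v : EuclideanSpace ℝ (Fin (n + 1))} (hv : 1 ≤ ‖v‖) :
    e v = G.jA (C.toFun ⟨‖v‖⁻¹ • v, norm_inv_smul_mem_sphere hv⟩ (‖v‖ - 1)) := by
  have := h₂ ⟨‖v‖⁻¹ • v, norm_inv_smul_mem_sphere hv⟩ (‖v‖ - 1) (sub_nonneg.2 hv)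
  rwa [Subtype.coe_mk, one_add_smul_norm_inv_smul hv] at this

/-- The cap chart meets the disc piece `jB(𝔻ⁿ⁺¹)` exactly on the closed unit ball. [folklore] -/
theorem capChart_mem_range_jB_iff
    (h₁ : ∀ (v : EuclideanSpace ℝ (Fin (n + 1))) (hv : ‖v‖ ≤ 1),
      e v = G.jB ⟨v, mem_closedBall_zero_iff.2 hv⟩)
    (h₂ : ∀ (z : sphere (0 : EuclideanSpace ℝ (Fin (n + 1))) 1) (t : ℝ), 0 ≤ t →
      e ((1 + t) • (z : EuclideanSpace ℝ (Fin (n + 1)))) = G.jA (C.toFun z t))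
    (v : EuclideanSpace ℝ (Fin (n + 1))) : e v ∈ range G.jB ↔ ‖v‖ ≤ 1 := by
  refine ⟨fun ⟨b, hb⟩ => ?_, fun hv => ⟨_, (h₁ v hv).symm⟩⟩
  by_contra hv
  rw [not_le] at hv
  rw [capChart_apply_of_one_le c G C h₂ hv.le, eq_comm, cap_jA_eq_jB_iff] at hb
  obtain ⟨w, hw, -⟩ := hb
  rw [← NullCobordism.boundaryData_incl, ← C.apply_zero] at hw
  have := (C.eq_of_apply_eq (sub_nonneg.2 hv.le) le_rfl hw).2
  linarith

/-- The cap chart maps the closed unit ball onto the disc piece: `e(𝔻ⁿ⁺¹) = jB(𝔻ⁿ⁺¹)`.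
[folklore] -/
theorem image_closedBall_of_capChart
    (h₁ : ∀ (v : EuclideanSpace ℝ (Fin (n + 1))) (hv : ‖v‖ ≤ 1),
      e v = G.jB ⟨v, mem_closedBall_zero_iff.2 hv⟩) :
    e '' Metric.closedBall 0 1 = range G.jB := by
  refine Subset.antisymm ?_ ?_
  · rintro _ ⟨v, hv, rfl⟩
    exact ⟨_, (h₁ v (mem_closedBall_zero_iff.1 hv)).symm⟩
  · rintro _ ⟨b, rfl⟩
    refine ⟨b, b.2, ?_⟩
    rw [h₁ b (mem_closedBall_zero_iff.1 b.2)]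

/-- The centre of the cap chart is the centre of the disc. [folklore] -/
theorem capChart_zero
    (h₁ : ∀ (v : EuclideanSpace ℝ (Fin (n + 1))) (hv : ‖v‖ ≤ 1),
      e v = G.jB ⟨v, mem_closedBall_zero_iff.2 hv⟩) :
    e 0 = G.jB ⟨0, mem_closedBall_self zero_le_one⟩ := by
  rw [h₁ 0 (by simp)]

/-- The cap chart is injective (`jA`, `jB` and the collar are injective, and the chart meets the
disc piece exactly along the unit ball). [folklore] -/
theorem injective_capChart
    (h₁ : ∀ (v : EuclideanSpace ℝ (Fin (n + 1))) (hv : ‖v‖ ≤ 1),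
      e v = G.jB ⟨v, mem_closedBall_zero_iff.2 hv⟩)
    (h₂ : ∀ (z : sphere (0 : EuclideanSpace ℝ (Fin (n + 1))) 1) (t : ℝ), 0 ≤ t →
      e ((1 + t) • (z : EuclideanSpace ℝ (Fin (n + 1)))) = G.jA (C.toFun z t)) :
    Injective e := by
  intro u v huv
  by_cases hu : ‖u‖ ≤ 1 <;> by_cases hv : ‖v‖ ≤ 1
  · rw [h₁ u hu, h₁ v hv] at huv
    exact congrArg Subtype.val (G.injective_jB huv)
  · have : e v ∈ range G.jB := huv ▸ (capChart_mem_range_jB_iff c G C h₁ h₂ u).2 hu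
    exact absurd ((capChart_mem_range_jB_iff c G C h₁ h₂ v).1 this) hv
  · have : e u ∈ range G.jB := huv ▸ (capChart_mem_range_jB_iff c G C h₁ h₂ v).2 hv
    exact absurd ((capChart_mem_range_jB_iff c G C h₁ h₂ u).1 this) hu
  · rw [not_le] at hu hv
    rw [capChart_apply_of_one_le c G C h₂ hu.le, capChart_apply_of_one_le c G C h₂ hv.le] at huv
    have h := C.eq_of_apply_eq (sub_nonneg.2 hu.le) (sub_nonneg.2 hv.le) (G.injective_jA huv)
    have hn : ‖u‖ = ‖v‖ := by linarith [h.2]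
    have hd := congrArg Subtype.val h.1
    simp only [hn] at hd
    rw [← one_add_smul_norm_inv_smul hu.le, ← one_add_smul_norm_inv_smul hv.le, hn, hd]

/-- The cap chart is continuous: on the closed unit ball it is `jB`, on `{1 ≤ ‖v‖}` it is
`jA ∘ C` in polar coordinates, and these closed sets cover `ℝⁿ⁺¹`. [folklore] -/
theorem continuous_capChart
    (h₁ : ∀ (v : EuclideanSpace ℝ (Fin (n + 1))) (hv : ‖v‖ ≤ 1),
      e v = G.jB ⟨v, mem_closedBall_zero_iff.2 hv⟩)
    (h₂ : ∀ (z : sphere (0 : EuclideanSpace ℝ (Fin (n + 1))) 1) (t : ℝ), 0 ≤ t →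
      e ((1 + t) • (z : EuclideanSpace ℝ (Fin (n + 1)))) = G.jA (C.toFun z t)) :
    Continuous e := by
  refine continuous_of_continuousOn_union_isClosed
    (s := Metric.closedBall (0 : EuclideanSpace ℝ (Fin (n + 1))) 1)
    (t := {v : EuclideanSpace ℝ (Fin (n + 1)) | 1 ≤ ‖v‖}) isClosed_closedBall
    (isClosed_le continuous_const continuous_norm) ?_ ?_ ?_
  · exact eq_univ_of_forall fun v => (le_total ‖v‖ 1).imp mem_closedBall_zero_iff.2 id
  · rw [continuousOn_iff_continuous_restrict]
    have : (Metric.closedBall (0 : EuclideanSpace ℝ (Fin (n + 1))) 1).restrict e = G.jB := by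
      funext b
      rw [restrict_apply, h₁ b (mem_closedBall_zero_iff.1 b.2)]
    rw [this]
    exact G.continuous_jB
  · rw [continuousOn_iff_continuous_restrict]
    -- polar coordinates `v ↦ (v/‖v‖, ‖v‖ - 1)` on `{1 ≤ ‖v‖}`
    set pol : {v : EuclideanSpace ℝ (Fin (n + 1)) | 1 ≤ ‖v‖} →
        sphere (0 : EuclideanSpace ℝ (Fin (n + 1))) 1 × ℝ := fun v =>
      (⟨‖(v : EuclideanSpace ℝ (Fin (n + 1)))‖⁻¹ • (v : EuclideanSpace ℝ (Fin (n + 1))),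
        norm_inv_smul_mem_sphere v.2⟩, ‖(v : EuclideanSpace ℝ (Fin (n + 1)))‖ - 1) with hpol_def
    have hpol : Continuous pol := by
      refine Continuous.prodMk ?_ (continuous_subtype_val.norm.sub continuous_const)
      exact ((continuous_subtype_val.norm.inv₀ fun v => by
        have := v.2; simp only [mem_setOf_eq] at this; linarith).smul
          continuous_subtype_val).subtype_mk _
    have hcomp : Continuous fun v => G.jA (uncurry C.toFun (pol v)) :=
      G.continuous_jA.comp (C.continuousOn_toFun.comp_continuous hpol fun v =>
        ⟨mem_univ _, mem_Ici.2 (sub_nonneg.2 v.2)⟩)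
    convert hcomp using 1
    funext v
    exact capChart_apply_of_one_le c G C h₂ v.2

/-- The trace of an image `e(U)` on the disc piece: `jB ⁻¹ (e U) = U ∩ 𝔻ⁿ⁺¹`. [folklore] -/
theorem preimage_jB_image_capChart
    (h₁ : ∀ (v : EuclideanSpace ℝ (Fin (n + 1))) (hv : ‖v‖ ≤ 1),
      e v = G.jB ⟨v, mem_closedBall_zero_iff.2 hv⟩)
    (h₂ : ∀ (z : sphere (0 : EuclideanSpace ℝ (Fin (n + 1))) 1) (t : ℝ), 0 ≤ t →
      e ((1 + t) • (z : EuclideanSpace ℝ (Fin (n + 1)))) = G.jA (C.toFun z t))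
    (U : Set (EuclideanSpace ℝ (Fin (n + 1)))) : G.jB ⁻¹' (e '' U) = Subtype.val ⁻¹' U := by
  ext b
  constructor
  · rintro ⟨u, hu, hub⟩
    have hu1 : ‖u‖ ≤ 1 := (capChart_mem_range_jB_iff c G C h₁ h₂ u).1 ⟨b, hub.symm⟩
    rw [h₁ u hu1] at hub
    have := congrArg Subtype.val (G.injective_jB hub)
    simp only at this
    rw [mem_preimage, ← this]
    exact hu
  · intro hb
    exact ⟨b, hb, h₁ b (mem_closedBall_zero_iff.1 b.2)⟩

/-- The trace of an image `e(U)` on the piece `M₀`: the collar image of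
`{(z, t) | (1 + t) z ∈ U}`, i.e. `{a ∈ region | (1 + height a) (proj a) ∈ U}`. [folklore] -/
theorem preimage_jA_image_capChart
    (h₁ : ∀ (v : EuclideanSpace ℝ (Fin (n + 1))) (hv : ‖v‖ ≤ 1),
      e v = G.jB ⟨v, mem_closedBall_zero_iff.2 hv⟩)
    (h₂ : ∀ (z : sphere (0 : EuclideanSpace ℝ (Fin (n + 1))) 1) (t : ℝ), 0 ≤ t →
      e ((1 + t) • (z : EuclideanSpace ℝ (Fin (n + 1)))) = G.jA (C.toFun z t))
    (U : Set (EuclideanSpace ℝ (Fin (n + 1)))) :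
    G.jA ⁻¹' (e '' U) = C.region ∩ (fun a => (1 + C.height a) •
      ((show sphere (0 : EuclideanSpace ℝ (Fin (n + 1))) 1 from C.proj a) :
        EuclideanSpace ℝ (Fin (n + 1)))) ⁻¹' U := by
  ext a
  constructor
  · rintro ⟨u, hu, hua⟩
    by_cases hu1 : 1 ≤ ‖u‖
    · rw [capChart_apply_of_one_le c G C h₂ hu1] at hua
      have ha := G.injective_jA hua
      have ht : 0 ≤ ‖u‖ - 1 := sub_nonneg.2 hu1
      refine ⟨ha ▸ C.mem_region _ _ ht, ?_⟩
      rw [mem_preimage, ← ha, C.height_apply _ _ ht, C.proj_apply _ _ ht]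
      change (1 + (‖u‖ - 1)) • (‖u‖⁻¹ • u) ∈ U
      rw [one_add_smul_norm_inv_smul hu1]
      exact hu
    · exfalso
      rw [not_le] at hu1
      rw [h₁ u hu1.le, eq_comm, cap_jA_eq_jB_iff] at hua
      obtain ⟨z, -, hz⟩ := hua
      have := congrArg (fun w : EuclideanSpace ℝ (Fin (n + 1)) => ‖w‖) hz
      simp only [norm_eq_of_mem_sphere] at this
      linarith
  · rintro ⟨ha, hu⟩
    refine ⟨_, hu, ?_⟩
    change e ((1 + C.height a) •
      ((show sphere (0 : EuclideanSpace ℝ (Fin (n + 1))) 1 from C.proj a) :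
        EuclideanSpace ℝ (Fin (n + 1)))) = G.jA a
    rw [h₂ _ _ (C.height_nonneg a ha), C.apply_proj_height a ha]

/-- The cap chart is an open map: by the open-cover criterion of the gluing
(`BoundaryGluingData.isOpen_of_preimage`) it suffices that the traces of `e(U)` on the two pieces
are open, which they are by the two preceding descriptions (the collar inverse `(proj, height)` is
continuous on the open `region`). [folklore] -/
theorem isOpenMap_capChart [IsManifold (𝓡 (n + 1)) ∞ X]
    (h₁ : ∀ (v : EuclideanSpace ℝ (Fin (n + 1))) (hv : ‖v‖ ≤ 1),
      e v = G.jB ⟨v, mem_closedBall_zero_iff.2 hv⟩)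
    (h₂ : ∀ (z : sphere (0 : EuclideanSpace ℝ (Fin (n + 1))) 1) (t : ℝ), 0 ≤ t →
      e ((1 + t) • (z : EuclideanSpace ℝ (Fin (n + 1)))) = G.jA (C.toFun z t)) :
    IsOpenMap e := by
  intro U hU
  refine G.isOpen_of_preimage ?_ ?_
  · rw [preimage_jA_image_capChart c G C h₁ h₂ U]
    refine ContinuousOn.isOpen_inter_preimage ?_ C.isOpen_region hU
    exact (continuousOn_const.add C.continuousOn_height).smul
      (continuous_subtype_val.comp_continuousOn C.continuousOn_proj)
  · rw [preimage_jB_image_capChart c G C h₁ h₂ U]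
    exact continuous_subtype_val.isOpen_preimage U hU

/-- **The cap chart is an open embedding** `ℝⁿ⁺¹ → X = M₀ ∪_{𝕊ⁿ} 𝔻ⁿ⁺¹` onto the union of the
disc and the collar of `bM₀`. [folklore] -/
theorem isOpenEmbedding_of_capChart [IsManifold (𝓡 (n + 1)) ∞ X]
    (h₁ : ∀ (v : EuclideanSpace ℝ (Fin (n + 1))) (hv : ‖v‖ ≤ 1),
      e v = G.jB ⟨v, mem_closedBall_zero_iff.2 hv⟩)
    (h₂ : ∀ (z : sphere (0 : EuclideanSpace ℝ (Fin (n + 1))) 1) (t : ℝ), 0 ≤ t →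
      e ((1 + t) • (z : EuclideanSpace ℝ (Fin (n + 1)))) = G.jA (C.toFun z t)) :
    IsOpenEmbedding e :=
  .of_continuous_injective_isOpenMap (continuous_capChart c G C h₁ h₂)
    (injective_capChart c G C h₁ h₂) (isOpenMap_capChart c G C h₁ h₂)

end NullCobordism

end Literature.Topology.FourManifolds
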